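import Mathlib
import Summits.MatrixMultiplication.MatrixMultiplication.Theorems.SubgroupIdentityDesigns.Negative.SingerCycle
import Summits.MatrixMultiplication.MatrixMultiplication.Theorems.SubgroupIdentityDesigns.Negative.OrbitPairRight

/-!
# The Dickson near-field group acts regularly on non-zero vectors (all odd `p`)

Route `LevelGradedCohnUmans`, crux `SubgroupIdentityDesigns`, the `(m,k) = (2,1)` cell, `p`-free
case.  `TransitiveTorus` / `OrbitPairRight` exclude the level-`1` identity design whenever one
member contains a subgroup `K` acting FREELY and TRANSITIVELY on `𝔽_p² ∖ 0` and another member has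
an element outside `K`; `SingerCycle` discharges this for the Singer cycle `C_{p²-1}`.  Here the
second regular subgroup of `ΓL₁(𝔽_{p²}) = N(C_ns)` is treated — the multiplicative group of the
DICKSON NEAR-FIELD of order `p²`:
`K = {[[x, n y],[y, x]] : x² - n y² ∈ (𝔽_p^×)²} ∪ {[[x, -n y],[y, -x]] : x² - n y² ∉ (𝔽_p^×)²}`
(`n` a non-square; the squares of the Singer cycle together with `c·σ`, `σ = diag(1,-1)`, for the
Singer elements `c` of non-square norm).  It has order `p² - 1`, is NOT cyclic, contains no
reflection of `O₂⁻(𝔽_p)` and is not contained in a Singer cycle, so it escapes `NormOneTorus` and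
`SingerCycle`; at `p = 5` it is the member class `Z·C₃·⟨u·Frob⟩` (class 36, order 24, profiles
`(6,6,24)`, `(6,24,6)`, `(24,6,6)` above the floor) left open in `WitnessStatus`.
* `nearField_free`: `K` acts freely (type 1: anisotropy, `shape_kernel`; type 2: a fixed vector
  forces `x² - n y² = 1`, a square);
* `nearField_transitive`: for `a, v ≠ 0` the Singer element `M(v)M(a)⁻¹` (norm `N(v)/N(a)`) or
  the twisted element `M(v)M(σa)⁻¹σ` (same norm) lies in `K` according as `N(v)/N(a)` is a square
  or not, and maps `a ↦ v`;
* `no_levelOne_design_of_nearField₂₁/₃₁/₃₂/₁₂/₁₃/₂₃`: all six placements (`K ≤ Hᵢ`,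
  `k₀ ∈ Hⱼ ∖ K`).  All `p` admitting a non-square; no TPP, no volume hypothesis.
VALUE = THEOREM, NOT summit progress; the crux item stmt-MatrixMultiplication-14079 is untouched
and remains open.
-/

set_option linter.dupNamespace false

noncomputable section

open scoped BigOperators Classical

open Summit.MatrixMultiplication.MatrixMultiplication.Theorems.LieRankDesigns.Negative (GLm Mat)

namespace Summit.MatrixMultiplication.MatrixMultiplication.Theorems.SubgroupIdentityDesigns.Negative

section DicksonNearField

variable {p : ℕ} [hp : Fact p.Prime]

/-- **The near-field group acts freely on non-zero vectors.** -/
theorem nearField_free {n : ZMod p} (hn : ∀ x : ZMod p, x * x ≠ n) {K : Subgroup (GLm p 2)}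
    (hKshape : ∀ k ∈ K,
      (((k : GLm p 2) : Mat p 2) 0 1 = n * ((k : GLm p 2) : Mat p 2) 1 0 ∧
        ((k : GLm p 2) : Mat p 2) 1 1 = ((k : GLm p 2) : Mat p 2) 0 0 ∧
        IsSquare (((k : GLm p 2) : Mat p 2) 0 0 * ((k : GLm p 2) : Mat p 2) 0 0 -
          n * (((k : GLm p 2) : Mat p 2) 1 0 * ((k : GLm p 2) : Mat p 2) 1 0))) ∨
      (((k : GLm p 2) : Mat p 2) 0 1 = -(n * ((k : GLm p 2) : Mat p 2) 1 0) ∧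
        ((k : GLm p 2) : Mat p 2) 1 1 = -((k : GLm p 2) : Mat p 2) 0 0 ∧
        ¬ IsSquare (((k : GLm p 2) : Mat p 2) 0 0 * ((k : GLm p 2) : Mat p 2) 0 0 -
          n * (((k : GLm p 2) : Mat p 2) 1 0 * ((k : GLm p 2) : Mat p 2) 1 0)))) :
    ∀ a : Fin 2 → ZMod p, a ≠ 0 → ∀ k ∈ K, ∀ k' ∈ K,
      ((k : GLm p 2) : Mat p 2).mulVec a = ((k' : GLm p 2) : Mat p 2).mulVec a → k = k' := by
  -- it suffices that a `g ∈ K` fixing `a ≠ 0` is trivial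
  suffices hfix : ∀ a : Fin 2 → ZMod p, a ≠ 0 → ∀ g ∈ K,
      ((g : GLm p 2) : Mat p 2).mulVec a = a → g = 1 by
    intro a ha k hk k' hk' e
    have hg : ((k'⁻¹ * k : GLm p 2) : Mat p 2).mulVec a = a := by
      rw [Units.val_mul, ← Matrix.mulVec_mulVec, e, Matrix.mulVec_mulVec, ← Units.val_mul,
        inv_mul_cancel, Units.val_one, Matrix.one_mulVec]
    have h1 := hfix a ha (k'⁻¹ * k) (K.mul_mem (K.inv_mem hk') hk) hg
    exact (inv_mul_eq_one.mp h1).symm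
  intro a ha g hg e
  have e0 := congr_fun e 0
  have e1 := congr_fun e 1
  rw [mulVec_two_apply_zero] at e0
  rw [mulVec_two_apply_one] at e1
  rcases hKshape g hg with ⟨h01, h11, -⟩ | ⟨h01, h11, hns⟩
  · -- type 1: `(g - 1) a = 0` with `g - 1` of Singer shape ⇒ `g = 1`
    obtain ⟨hX, hY⟩ := shape_kernel hn ha (X := ((g : GLm p 2) : Mat p 2) 0 0 - 1)
      (Y := ((g : GLm p 2) : Mat p 2) 1 0)
      (by linear_combination e0 - a 1 * h01) (by linear_combination e1 - a 1 * h11)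
    have h00 : ((g : GLm p 2) : Mat p 2) 0 0 = 1 := sub_eq_zero.mp hX
    refine gl2_ext ?_ ?_ ?_ ?_
    · rw [h00, Units.val_one, Matrix.one_apply_eq]
    · rw [h01, hY, mul_zero, Units.val_one, Matrix.one_apply_ne (by decide)]
    · rw [hY, Units.val_one, Matrix.one_apply_ne (by decide)]
    · rw [h11, h00, Units.val_one, Matrix.one_apply_eq]
  · -- type 2: a fixed vector forces `x² - n y² = 1`, a square
    exfalso
    set x := ((g : GLm p 2) : Mat p 2) 0 0 with hx
    set y := ((g : GLm p 2) : Mat p 2) 1 0 with hy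
    have E0 : (x - 1) * a 0 - n * y * a 1 = 0 := by linear_combination e0 - a 1 * h01
    have E1 : y * a 0 - (x + 1) * a 1 = 0 := by linear_combination e1 - a 1 * h11
    have hQ0 : (x * x - n * (y * y) - 1) * a 0 = 0 := by
      linear_combination (x + 1) * E0 - n * y * E1
    have hQ1 : (x * x - n * (y * y) - 1) * a 1 = 0 := by
      linear_combination y * E0 - (x - 1) * E1
    by_cases hD : x * x - n * (y * y) - 1 = 0
    · exact hns ⟨1, by linear_combination hD⟩
    · apply ha
      funext i
      fin_cases i
      · simpa [hD] using hQ0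
      · simpa [hD] using hQ1

/-- The norm form of a quotient: `N₁² - n N₂² = P Q`, `Q ≠ 0` ⇒ `(N₁/Q)² - n (N₂/Q)² = P/Q`. -/
theorem div_form_eq_div {n N₁ N₂ P Q : ZMod p} (hQ : Q ≠ 0) (hB : N₁ * N₁ - n * (N₂ * N₂) = P * Q) :
    N₁ / Q * (N₁ / Q) - n * (N₂ / Q * (N₂ / Q)) = P / Q := by
  rw [div_mul_div_comm, div_mul_div_comm, ← mul_div_assoc, ← sub_div, hB,
    mul_div_mul_right _ _ hQ]

/-- **The near-field group acts transitively on non-zero vectors.** -/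
theorem nearField_transitive {n : ZMod p} (hn : ∀ x : ZMod p, x * x ≠ n) {K : Subgroup (GLm p 2)}
    (hKall₁ : ∀ k : GLm p 2, (k : Mat p 2) 0 1 = n * (k : Mat p 2) 1 0 →
      (k : Mat p 2) 1 1 = (k : Mat p 2) 0 0 →
      IsSquare ((k : Mat p 2) 0 0 * (k : Mat p 2) 0 0 - n * ((k : Mat p 2) 1 0 * (k : Mat p 2) 1 0)) →
      k ∈ K)
    (hKall₂ : ∀ k : GLm p 2, (k : Mat p 2) 0 1 = -(n * (k : Mat p 2) 1 0) →
      (k : Mat p 2) 1 1 = -(k : Mat p 2) 0 0 →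
      ¬ IsSquare ((k : Mat p 2) 0 0 * (k : Mat p 2) 0 0 -
        n * ((k : Mat p 2) 1 0 * (k : Mat p 2) 1 0)) →
      k ∈ K) :
    ∀ a : Fin 2 → ZMod p, a ≠ 0 → ∀ v : Fin 2 → ZMod p, v ≠ 0 → ∃ k ∈ K,
      ((k : GLm p 2) : Mat p 2).mulVec a = v := by
  intro a ha v hv
  have hQa := normForm_ne_zero hn ha
  have hQv := normForm_ne_zero hn hv
  set Q := a 0 * a 0 - n * (a 1 * a 1) with hQ
  set P := v 0 * v 0 - n * (v 1 * v 1) with hP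
  have hPQ : P / Q ≠ 0 := div_ne_zero hQv hQa
  by_cases hsq : IsSquare (P / Q)
  · -- the Singer element `M(v) M(a)⁻¹`, of square norm `P/Q`
    set N₁ := v 0 * a 0 - n * (v 1 * a 1) with hN₁
    set N₂ := v 1 * a 0 - v 0 * a 1 with hN₂
    have hB : N₁ * N₁ - n * (N₂ * N₂) = P * Q := by rw [hN₁, hN₂, hP, hQ]; ring
    have hform : N₁ / Q * (N₁ / Q) - n * (N₂ / Q * (N₂ / Q)) = P / Q := div_form_eq_div hQa hB
    obtain ⟨k, h00, h01, h10, h11⟩ := exists_gl2 (N₁ / Q) (n * (N₂ / Q)) (N₂ / Q) (N₁ / Q)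
      (by rw [show N₁ / Q * (N₁ / Q) - n * (N₂ / Q) * (N₂ / Q) =
          N₁ / Q * (N₁ / Q) - n * (N₂ / Q * (N₂ / Q)) by ring, hform]; exact hPQ)
    refine ⟨k, hKall₁ k (by rw [h01, h10]) (by rw [h11, h00]) (by rw [h00, h10, hform]; exact hsq),
      ?_⟩
    funext i
    fin_cases i
    · simp only [Fin.zero_eta, Fin.isValue]
      rw [mulVec_two_apply_zero, h00, h01,
        show N₁ / Q * a 0 + n * (N₂ / Q) * a 1 = (N₁ * a 0 + n * N₂ * a 1) / Q by ring,
        div_eq_iff hQa, hN₁, hN₂, hQ]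
      ring
    · simp only [Fin.mk_one, Fin.isValue]
      rw [mulVec_two_apply_one, h10, h11,
        show N₂ / Q * a 0 + N₁ / Q * a 1 = (N₂ * a 0 + N₁ * a 1) / Q by ring,
        div_eq_iff hQa, hN₁, hN₂, hQ]
      ring
  · -- the twisted element `M(v) M(σ a)⁻¹ σ`, of the same (non-square) norm
    set N₁ := v 0 * a 0 + n * (v 1 * a 1) with hN₁
    set N₂ := v 1 * a 0 + v 0 * a 1 with hN₂
    have hB : N₁ * N₁ - n * (N₂ * N₂) = P * Q := by rw [hN₁, hN₂, hP, hQ]; ring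
    have hform : N₁ / Q * (N₁ / Q) - n * (N₂ / Q * (N₂ / Q)) = P / Q := div_form_eq_div hQa hB
    obtain ⟨k, h00, h01, h10, h11⟩ := exists_gl2 (N₁ / Q) (-(n * (N₂ / Q))) (N₂ / Q) (-(N₁ / Q))
      (by rw [show N₁ / Q * -(N₁ / Q) - -(n * (N₂ / Q)) * (N₂ / Q) =
          -(N₁ / Q * (N₁ / Q) - n * (N₂ / Q * (N₂ / Q))) by ring, hform]
          exact neg_ne_zero.mpr hPQ)
    refine ⟨k, hKall₂ k (by rw [h01, h10]) (by rw [h11, h00]) (by rw [h00, h10, hform]; exact hsq),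
      ?_⟩
    funext i
    fin_cases i
    · simp only [Fin.zero_eta, Fin.isValue]
      rw [mulVec_two_apply_zero, h00, h01,
        show N₁ / Q * a 0 + -(n * (N₂ / Q)) * a 1 = (N₁ * a 0 - n * N₂ * a 1) / Q by ring,
        div_eq_iff hQa, hN₁, hN₂, hQ]
      ring
    · simp only [Fin.mk_one, Fin.isValue]
      rw [mulVec_two_apply_one, h10, h11,
        show N₂ / Q * a 0 + -(N₁ / Q) * a 1 = (N₂ * a 0 - N₁ * a 1) / Q by ring,
        div_eq_iff hQa, hN₁, hN₂, hQ]
      ring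


/-! ### The six placements -/

/-- **Near-field group in `H₂`, an element of `H₁` outside it ⇒ no level-one identity
design** (all `p` with a non-square `n`; no TPP). -/
theorem no_levelOne_design_of_nearField₂₁ {H₁ H₂ H₃ : Subgroup (GLm p 2)}
    (n : ZMod p) (hn : ∀ x : ZMod p, x * x ≠ n) (K : Subgroup (GLm p 2))
    (hKshape : ∀ k ∈ K,
      (((k : GLm p 2) : Mat p 2) 0 1 = n * ((k : GLm p 2) : Mat p 2) 1 0 ∧
        ((k : GLm p 2) : Mat p 2) 1 1 = ((k : GLm p 2) : Mat p 2) 0 0 ∧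
        IsSquare (((k : GLm p 2) : Mat p 2) 0 0 * ((k : GLm p 2) : Mat p 2) 0 0 -
          n * (((k : GLm p 2) : Mat p 2) 1 0 * ((k : GLm p 2) : Mat p 2) 1 0))) ∨
      (((k : GLm p 2) : Mat p 2) 0 1 = -(n * ((k : GLm p 2) : Mat p 2) 1 0) ∧
        ((k : GLm p 2) : Mat p 2) 1 1 = -((k : GLm p 2) : Mat p 2) 0 0 ∧
        ¬ IsSquare (((k : GLm p 2) : Mat p 2) 0 0 * ((k : GLm p 2) : Mat p 2) 0 0 -
          n * (((k : GLm p 2) : Mat p 2) 1 0 * ((k : GLm p 2) : Mat p 2) 1 0))))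
    (hKall₁ : ∀ k : GLm p 2, (k : Mat p 2) 0 1 = n * (k : Mat p 2) 1 0 →
      (k : Mat p 2) 1 1 = (k : Mat p 2) 0 0 →
      IsSquare ((k : Mat p 2) 0 0 * (k : Mat p 2) 0 0 - n * ((k : Mat p 2) 1 0 * (k : Mat p 2) 1 0)) →
      k ∈ K)
    (hKall₂ : ∀ k : GLm p 2, (k : Mat p 2) 0 1 = -(n * (k : Mat p 2) 1 0) →
      (k : Mat p 2) 1 1 = -(k : Mat p 2) 0 0 →
      ¬ IsSquare ((k : Mat p 2) 0 0 * (k : Mat p 2) 0 0 -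
        n * ((k : Mat p 2) 1 0 * (k : Mat p 2) 1 0)) →
      k ∈ K)
    (hKH : K ≤ H₂) (k₀ : GLm p 2) (hk₀ : k₀ ∈ H₁) (hk₀K : k₀ ∉ K) :
    ¬ ∃ c : Mat p 2 → ℂ, (∀ M, 1 < M.rank → c M = 0) ∧
      (∑ M, c M * ZMod.stdAddChar (Matrix.trace (M * ((1 : GLm p 2) : Mat p 2)))) = 1 ∧
      ∀ a ∈ H₁, ∀ b ∈ H₂, ∀ g ∈ H₃, a * b * g ≠ 1 →
        (∑ M, c M *
          ZMod.stdAddChar (Matrix.trace (M * ((a * b * g : GLm p 2) : Mat p 2)))) = 0 :=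
  no_levelOne_design_of_transitive₂₁ K hKH k₀ hk₀ hk₀K (nearField_free hn hKshape)
    (nearField_transitive hn hKall₁ hKall₂)

/-- **Near-field group in `H₃`, an element of `H₁` outside it ⇒ no level-one identity
design** (all `p` with a non-square `n`; no TPP). -/
theorem no_levelOne_design_of_nearField₃₁ {H₁ H₂ H₃ : Subgroup (GLm p 2)}
    (n : ZMod p) (hn : ∀ x : ZMod p, x * x ≠ n) (K : Subgroup (GLm p 2))
    (hKshape : ∀ k ∈ K,
      (((k : GLm p 2) : Mat p 2) 0 1 = n * ((k : GLm p 2) : Mat p 2) 1 0 ∧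
        ((k : GLm p 2) : Mat p 2) 1 1 = ((k : GLm p 2) : Mat p 2) 0 0 ∧
        IsSquare (((k : GLm p 2) : Mat p 2) 0 0 * ((k : GLm p 2) : Mat p 2) 0 0 -
          n * (((k : GLm p 2) : Mat p 2) 1 0 * ((k : GLm p 2) : Mat p 2) 1 0))) ∨
      (((k : GLm p 2) : Mat p 2) 0 1 = -(n * ((k : GLm p 2) : Mat p 2) 1 0) ∧
        ((k : GLm p 2) : Mat p 2) 1 1 = -((k : GLm p 2) : Mat p 2) 0 0 ∧
        ¬ IsSquare (((k : GLm p 2) : Mat p 2) 0 0 * ((k : GLm p 2) : Mat p 2) 0 0 -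
          n * (((k : GLm p 2) : Mat p 2) 1 0 * ((k : GLm p 2) : Mat p 2) 1 0))))
    (hKall₁ : ∀ k : GLm p 2, (k : Mat p 2) 0 1 = n * (k : Mat p 2) 1 0 →
      (k : Mat p 2) 1 1 = (k : Mat p 2) 0 0 →
      IsSquare ((k : Mat p 2) 0 0 * (k : Mat p 2) 0 0 - n * ((k : Mat p 2) 1 0 * (k : Mat p 2) 1 0)) →
      k ∈ K)
    (hKall₂ : ∀ k : GLm p 2, (k : Mat p 2) 0 1 = -(n * (k : Mat p 2) 1 0) →
      (k : Mat p 2) 1 1 = -(k : Mat p 2) 0 0 →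
      ¬ IsSquare ((k : Mat p 2) 0 0 * (k : Mat p 2) 0 0 -
        n * ((k : Mat p 2) 1 0 * (k : Mat p 2) 1 0)) →
      k ∈ K)
    (hKH : K ≤ H₃) (k₀ : GLm p 2) (hk₀ : k₀ ∈ H₁) (hk₀K : k₀ ∉ K) :
    ¬ ∃ c : Mat p 2 → ℂ, (∀ M, 1 < M.rank → c M = 0) ∧
      (∑ M, c M * ZMod.stdAddChar (Matrix.trace (M * ((1 : GLm p 2) : Mat p 2)))) = 1 ∧
      ∀ a ∈ H₁, ∀ b ∈ H₂, ∀ g ∈ H₃, a * b * g ≠ 1 →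
        (∑ M, c M *
          ZMod.stdAddChar (Matrix.trace (M * ((a * b * g : GLm p 2) : Mat p 2)))) = 0 :=
  no_levelOne_design_of_transitive₃₁ K hKH k₀ hk₀ hk₀K (nearField_free hn hKshape)
    (nearField_transitive hn hKall₁ hKall₂)

/-- **Near-field group in `H₃`, an element of `H₂` outside it ⇒ no level-one identity
design** (all `p` with a non-square `n`; no TPP). -/
theorem no_levelOne_design_of_nearField₃₂ {H₁ H₂ H₃ : Subgroup (GLm p 2)}
    (n : ZMod p) (hn : ∀ x : ZMod p, x * x ≠ n) (K : Subgroup (GLm p 2))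
    (hKshape : ∀ k ∈ K,
      (((k : GLm p 2) : Mat p 2) 0 1 = n * ((k : GLm p 2) : Mat p 2) 1 0 ∧
        ((k : GLm p 2) : Mat p 2) 1 1 = ((k : GLm p 2) : Mat p 2) 0 0 ∧
        IsSquare (((k : GLm p 2) : Mat p 2) 0 0 * ((k : GLm p 2) : Mat p 2) 0 0 -
          n * (((k : GLm p 2) : Mat p 2) 1 0 * ((k : GLm p 2) : Mat p 2) 1 0))) ∨
      (((k : GLm p 2) : Mat p 2) 0 1 = -(n * ((k : GLm p 2) : Mat p 2) 1 0) ∧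
        ((k : GLm p 2) : Mat p 2) 1 1 = -((k : GLm p 2) : Mat p 2) 0 0 ∧
        ¬ IsSquare (((k : GLm p 2) : Mat p 2) 0 0 * ((k : GLm p 2) : Mat p 2) 0 0 -
          n * (((k : GLm p 2) : Mat p 2) 1 0 * ((k : GLm p 2) : Mat p 2) 1 0))))
    (hKall₁ : ∀ k : GLm p 2, (k : Mat p 2) 0 1 = n * (k : Mat p 2) 1 0 →
      (k : Mat p 2) 1 1 = (k : Mat p 2) 0 0 →
      IsSquare ((k : Mat p 2) 0 0 * (k : Mat p 2) 0 0 - n * ((k : Mat p 2) 1 0 * (k : Mat p 2) 1 0)) →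
      k ∈ K)
    (hKall₂ : ∀ k : GLm p 2, (k : Mat p 2) 0 1 = -(n * (k : Mat p 2) 1 0) →
      (k : Mat p 2) 1 1 = -(k : Mat p 2) 0 0 →
      ¬ IsSquare ((k : Mat p 2) 0 0 * (k : Mat p 2) 0 0 -
        n * ((k : Mat p 2) 1 0 * (k : Mat p 2) 1 0)) →
      k ∈ K)
    (hKH : K ≤ H₃) (k₀ : GLm p 2) (hk₀ : k₀ ∈ H₂) (hk₀K : k₀ ∉ K) :
    ¬ ∃ c : Mat p 2 → ℂ, (∀ M, 1 < M.rank → c M = 0) ∧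
      (∑ M, c M * ZMod.stdAddChar (Matrix.trace (M * ((1 : GLm p 2) : Mat p 2)))) = 1 ∧
      ∀ a ∈ H₁, ∀ b ∈ H₂, ∀ g ∈ H₃, a * b * g ≠ 1 →
        (∑ M, c M *
          ZMod.stdAddChar (Matrix.trace (M * ((a * b * g : GLm p 2) : Mat p 2)))) = 0 :=
  no_levelOne_design_of_transitive₃₂ K hKH k₀ hk₀ hk₀K (nearField_free hn hKshape)
    (nearField_transitive hn hKall₁ hKall₂)

/-- **Near-field group in `H₁`, an element of `H₂` outside it ⇒ no level-one identity
design** (all `p` with a non-square `n`; no TPP). -/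
theorem no_levelOne_design_of_nearField₁₂ {H₁ H₂ H₃ : Subgroup (GLm p 2)}
    (n : ZMod p) (hn : ∀ x : ZMod p, x * x ≠ n) (K : Subgroup (GLm p 2))
    (hKshape : ∀ k ∈ K,
      (((k : GLm p 2) : Mat p 2) 0 1 = n * ((k : GLm p 2) : Mat p 2) 1 0 ∧
        ((k : GLm p 2) : Mat p 2) 1 1 = ((k : GLm p 2) : Mat p 2) 0 0 ∧
        IsSquare (((k : GLm p 2) : Mat p 2) 0 0 * ((k : GLm p 2) : Mat p 2) 0 0 -
          n * (((k : GLm p 2) : Mat p 2) 1 0 * ((k : GLm p 2) : Mat p 2) 1 0))) ∨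
      (((k : GLm p 2) : Mat p 2) 0 1 = -(n * ((k : GLm p 2) : Mat p 2) 1 0) ∧
        ((k : GLm p 2) : Mat p 2) 1 1 = -((k : GLm p 2) : Mat p 2) 0 0 ∧
        ¬ IsSquare (((k : GLm p 2) : Mat p 2) 0 0 * ((k : GLm p 2) : Mat p 2) 0 0 -
          n * (((k : GLm p 2) : Mat p 2) 1 0 * ((k : GLm p 2) : Mat p 2) 1 0))))
    (hKall₁ : ∀ k : GLm p 2, (k : Mat p 2) 0 1 = n * (k : Mat p 2) 1 0 →
      (k : Mat p 2) 1 1 = (k : Mat p 2) 0 0 →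
      IsSquare ((k : Mat p 2) 0 0 * (k : Mat p 2) 0 0 - n * ((k : Mat p 2) 1 0 * (k : Mat p 2) 1 0)) →
      k ∈ K)
    (hKall₂ : ∀ k : GLm p 2, (k : Mat p 2) 0 1 = -(n * (k : Mat p 2) 1 0) →
      (k : Mat p 2) 1 1 = -(k : Mat p 2) 0 0 →
      ¬ IsSquare ((k : Mat p 2) 0 0 * (k : Mat p 2) 0 0 -
        n * ((k : Mat p 2) 1 0 * (k : Mat p 2) 1 0)) →
      k ∈ K)
    (hKH : K ≤ H₁) (k₀ : GLm p 2) (hk₀ : k₀ ∈ H₂) (hk₀K : k₀ ∉ K) :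
    ¬ ∃ c : Mat p 2 → ℂ, (∀ M, 1 < M.rank → c M = 0) ∧
      (∑ M, c M * ZMod.stdAddChar (Matrix.trace (M * ((1 : GLm p 2) : Mat p 2)))) = 1 ∧
      ∀ a ∈ H₁, ∀ b ∈ H₂, ∀ g ∈ H₃, a * b * g ≠ 1 →
        (∑ M, c M *
          ZMod.stdAddChar (Matrix.trace (M * ((a * b * g : GLm p 2) : Mat p 2)))) = 0 :=
  no_levelOne_design_of_transitive₁₂ K hKH k₀ hk₀ hk₀K (nearField_free hn hKshape)
    (nearField_transitive hn hKall₁ hKall₂)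

/-- **Near-field group in `H₁`, an element of `H₃` outside it ⇒ no level-one identity
design** (all `p` with a non-square `n`; no TPP). -/
theorem no_levelOne_design_of_nearField₁₃ {H₁ H₂ H₃ : Subgroup (GLm p 2)}
    (n : ZMod p) (hn : ∀ x : ZMod p, x * x ≠ n) (K : Subgroup (GLm p 2))
    (hKshape : ∀ k ∈ K,
      (((k : GLm p 2) : Mat p 2) 0 1 = n * ((k : GLm p 2) : Mat p 2) 1 0 ∧
        ((k : GLm p 2) : Mat p 2) 1 1 = ((k : GLm p 2) : Mat p 2) 0 0 ∧
        IsSquare (((k : GLm p 2) : Mat p 2) 0 0 * ((k : GLm p 2) : Mat p 2) 0 0 -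
          n * (((k : GLm p 2) : Mat p 2) 1 0 * ((k : GLm p 2) : Mat p 2) 1 0))) ∨
      (((k : GLm p 2) : Mat p 2) 0 1 = -(n * ((k : GLm p 2) : Mat p 2) 1 0) ∧
        ((k : GLm p 2) : Mat p 2) 1 1 = -((k : GLm p 2) : Mat p 2) 0 0 ∧
        ¬ IsSquare (((k : GLm p 2) : Mat p 2) 0 0 * ((k : GLm p 2) : Mat p 2) 0 0 -
          n * (((k : GLm p 2) : Mat p 2) 1 0 * ((k : GLm p 2) : Mat p 2) 1 0))))
    (hKall₁ : ∀ k : GLm p 2, (k : Mat p 2) 0 1 = n * (k : Mat p 2) 1 0 →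
      (k : Mat p 2) 1 1 = (k : Mat p 2) 0 0 →
      IsSquare ((k : Mat p 2) 0 0 * (k : Mat p 2) 0 0 - n * ((k : Mat p 2) 1 0 * (k : Mat p 2) 1 0)) →
      k ∈ K)
    (hKall₂ : ∀ k : GLm p 2, (k : Mat p 2) 0 1 = -(n * (k : Mat p 2) 1 0) →
      (k : Mat p 2) 1 1 = -(k : Mat p 2) 0 0 →
      ¬ IsSquare ((k : Mat p 2) 0 0 * (k : Mat p 2) 0 0 -
        n * ((k : Mat p 2) 1 0 * (k : Mat p 2) 1 0)) →
      k ∈ K)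
    (hKH : K ≤ H₁) (k₀ : GLm p 2) (hk₀ : k₀ ∈ H₃) (hk₀K : k₀ ∉ K) :
    ¬ ∃ c : Mat p 2 → ℂ, (∀ M, 1 < M.rank → c M = 0) ∧
      (∑ M, c M * ZMod.stdAddChar (Matrix.trace (M * ((1 : GLm p 2) : Mat p 2)))) = 1 ∧
      ∀ a ∈ H₁, ∀ b ∈ H₂, ∀ g ∈ H₃, a * b * g ≠ 1 →
        (∑ M, c M *
          ZMod.stdAddChar (Matrix.trace (M * ((a * b * g : GLm p 2) : Mat p 2)))) = 0 :=
  no_levelOne_design_of_transitive₁₃ K hKH k₀ hk₀ hk₀K (nearField_free hn hKshape)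
    (nearField_transitive hn hKall₁ hKall₂)

/-- **Near-field group in `H₂`, an element of `H₃` outside it ⇒ no level-one identity
design** (all `p` with a non-square `n`; no TPP). -/
theorem no_levelOne_design_of_nearField₂₃ {H₁ H₂ H₃ : Subgroup (GLm p 2)}
    (n : ZMod p) (hn : ∀ x : ZMod p, x * x ≠ n) (K : Subgroup (GLm p 2))
    (hKshape : ∀ k ∈ K,
      (((k : GLm p 2) : Mat p 2) 0 1 = n * ((k : GLm p 2) : Mat p 2) 1 0 ∧
        ((k : GLm p 2) : Mat p 2) 1 1 = ((k : GLm p 2) : Mat p 2) 0 0 ∧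
        IsSquare (((k : GLm p 2) : Mat p 2) 0 0 * ((k : GLm p 2) : Mat p 2) 0 0 -
          n * (((k : GLm p 2) : Mat p 2) 1 0 * ((k : GLm p 2) : Mat p 2) 1 0))) ∨
      (((k : GLm p 2) : Mat p 2) 0 1 = -(n * ((k : GLm p 2) : Mat p 2) 1 0) ∧
        ((k : GLm p 2) : Mat p 2) 1 1 = -((k : GLm p 2) : Mat p 2) 0 0 ∧
        ¬ IsSquare (((k : GLm p 2) : Mat p 2) 0 0 * ((k : GLm p 2) : Mat p 2) 0 0 -
          n * (((k : GLm p 2) : Mat p 2) 1 0 * ((k : GLm p 2) : Mat p 2) 1 0))))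
    (hKall₁ : ∀ k : GLm p 2, (k : Mat p 2) 0 1 = n * (k : Mat p 2) 1 0 →
      (k : Mat p 2) 1 1 = (k : Mat p 2) 0 0 →
      IsSquare ((k : Mat p 2) 0 0 * (k : Mat p 2) 0 0 - n * ((k : Mat p 2) 1 0 * (k : Mat p 2) 1 0)) →
      k ∈ K)
    (hKall₂ : ∀ k : GLm p 2, (k : Mat p 2) 0 1 = -(n * (k : Mat p 2) 1 0) →
      (k : Mat p 2) 1 1 = -(k : Mat p 2) 0 0 →
      ¬ IsSquare ((k : Mat p 2) 0 0 * (k : Mat p 2) 0 0 -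
        n * ((k : Mat p 2) 1 0 * (k : Mat p 2) 1 0)) →
      k ∈ K)
    (hKH : K ≤ H₂) (k₀ : GLm p 2) (hk₀ : k₀ ∈ H₃) (hk₀K : k₀ ∉ K) :
    ¬ ∃ c : Mat p 2 → ℂ, (∀ M, 1 < M.rank → c M = 0) ∧
      (∑ M, c M * ZMod.stdAddChar (Matrix.trace (M * ((1 : GLm p 2) : Mat p 2)))) = 1 ∧
      ∀ a ∈ H₁, ∀ b ∈ H₂, ∀ g ∈ H₃, a * b * g ≠ 1 →
        (∑ M, c M *
          ZMod.stdAddChar (Matrix.trace (M * ((a * b * g : GLm p 2) : Mat p 2)))) = 0 :=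
  no_levelOne_design_of_transitive₂₃ K hKH k₀ hk₀ hk₀K (nearField_free hn hKshape)
    (nearField_transitive hn hKall₁ hKall₂)

end DicksonNearField

end Summit.MatrixMultiplication.MatrixMultiplication.Theorems.SubgroupIdentityDesigns.Negative

end
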